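import Summits.CriticalPhenomena.PercolationContinuityZ3.Theorems.PercNearOneGluingNoHeavyPcintAdaptiveDomination
import HarnessLib

/-!
# PCINT lane, T-fibre route, tool: mixtures of i.i.d. laws dominate `π_s` on monotone tests iff their tails do

Cell `prim-pcint`, seat `prim-pcint-1` (gen 11); memo `run/shared/lean/prim/pcint/T-FIBRE-ROUTE.md` §4.
Generic finite-sum lemmas (no new facts, no `sorry`), feeding `AdaptDom.Dominating` for the fibre process.

For a finite set `C` of examined sites (`k = #C`) and a step test function `g` of `C` (`AdaptDom.StepTest`:
monotone in the values on `C`, blind to the other coordinates):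

* `AdaptDom.sum_wt_mul_eq_sum_powerset` — **level decomposition**:
  `E_{π_r}[g] = Σ_{A ⊆ C} r^{#A} (1-r)^{k-#A} g(𝟙_A)`;
* `AdaptDom.levelSum_mono` — **level averages of a monotone function increase**:
  `(k - ℓ) · Σ_{#A = ℓ} g(𝟙_A) ≤ (ℓ + 1) · Σ_{#A = ℓ+1} g(𝟙_A)` (double counting of the pairs `A ⊂ A ∪ {v}`);
* `AdaptDom.sum_wt_mul_eq_tails` — **Abel summation**: `E_{π_r}[g] = ḡ(0) + Σ_{j=1}^{k} (ḡ(j) - ḡ(j-1)) · T_j(r)`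
  with `ḡ(ℓ)` the average of `g` over the level `ℓ` and `T_j(r) = P(Bin(k, r) ≥ j)` (`binTail`);
* **`AdaptDom.mixture_dominates_of_tails`** — if a nonnegative combination of binomial tails dominates those of
  `Bin(k, s)`, i.e. `(Σ_x a_x) · T_j(s) ≤ Σ_x a_x · T_j(r_x)` for `j = 1, …, k`, then
  `(Σ_x a_x) · E_{π_s}[g] ≤ Σ_x a_x · E_{π_{r_x}}[g]` for every step test function `g` of `C`.

(For EXCHANGEABLE laws on `{0,1}^k` stochastic dominance is dominance of the number of successes.)
-/

namespace Summit.CriticalPhenomena.PercolationContinuityZ3.Theorems.Pcint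

namespace AdaptDom

open Finset

variable {V : Type*} [Fintype V] [DecidableEq V]

/-! ### Indicator configurations and the level decomposition -/

/-- The configuration `𝟙_A`: `true` exactly on `A`. -/
def indB (A : Finset V) : V → Bool := fun v => decide (v ∈ A)

omit [Fintype V] in
/-- `𝟙_A v = true ↔ v ∈ A`. -/
@[simp] theorem indB_apply_eq_true {A : Finset V} {v : V} : indB A v = true ↔ v ∈ A := by
  simp [indB]

/-- The set of `true` coordinates of a configuration. -/
def trueSet (ω : V → Bool) : Finset V := univ.filter fun v => ω v = true

omit [DecidableEq V] in
/-- `v ∈ trueSet ω ↔ ω v = true`. -/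
@[simp] theorem mem_trueSet {ω : V → Bool} {v : V} : v ∈ trueSet ω ↔ ω v = true := by
  simp [trueSet]

/-- Configurations are in bijection with their sets of `true` coordinates. -/
def trueSetEquiv : (V → Bool) ≃ Finset V where
  toFun := trueSet
  invFun := indB
  left_inv ω := by funext v; cases h : ω v <;> simp [indB, trueSet, h]
  right_inv A := by ext v; simp [indB, trueSet]

omit [DecidableEq V] in
/-- The product weight in terms of the set of `true` coordinates: `π_r(ω) = r^{#S} (1-r)^{#V - #S}`. -/
theorem wt_eq_pow (r : ℝ) (ω : V → Bool) :
    wt r ω = r ^ (trueSet ω).card * (1 - r) ^ (Fintype.card V - (trueSet ω).card) := by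
  unfold wt bern
  rw [← Finset.prod_filter_mul_prod_filter_not univ (fun v => ω v = true)]
  have h1 : ∏ v ∈ univ.filter (fun v => ω v = true), (if ω v = true then r else 1 - r) = r ^ (trueSet ω).card := by
    rw [Finset.prod_congr rfl fun v hv => by rw [if_pos (mem_filter.1 hv).2], prod_const]; rfl
  have h2 : ∏ v ∈ univ.filter (fun v => ¬ω v = true), (if ω v = true then r else 1 - r) =
      (1 - r) ^ (Fintype.card V - (trueSet ω).card) := by
    rw [Finset.prod_congr rfl fun v hv => by rw [if_neg (mem_filter.1 hv).2], prod_const]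
    congr 1
    have := Finset.card_filter_add_card_filter_not (s := (univ : Finset V)) (fun v => ω v = true)
    rw [Finset.card_univ] at this
    unfold trueSet; omega
  rw [h1, h2]

omit [Fintype V] in
/-- A step test function of `C` evaluated at `𝟙_S` only sees `S ∩ C`. -/
theorem stepTest_indB_inter {C : Finset V} {g : (V → Bool) → ℝ} (hg : StepTest C g) (S : Finset V) :
    g (indB S) = g (indB (S ∩ C)) :=
  hg.2 _ _ fun v hv => by simp [indB, hv]

/-- **Level decomposition of a product expectation of a step test function**:
`E_{π_r}[g] = Σ_{A ⊆ C} r^{#A} (1-r)^{#C-#A} g(𝟙_A)`. -/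
theorem sum_wt_mul_eq_sum_powerset {C : Finset V} {g : (V → Bool) → ℝ} (hg : StepTest C g) (r : ℝ) :
    ∑ ω : V → Bool, wt r ω * g ω = ∑ A ∈ C.powerset, r ^ A.card * (1 - r) ^ (C.card - A.card) * g (indB A) := by
  classical
  -- reindex by true sets
  have step1 : ∑ ω : V → Bool, wt r ω * g ω =
      ∑ S : Finset V, r ^ S.card * (1 - r) ^ (Fintype.card V - S.card) * g (indB (S ∩ C)) := by
    refine Fintype.sum_equiv trueSetEquiv _ _ fun ω => ?_
    rw [wt_eq_pow]
    have hω : indB (trueSet ω) = ω := trueSetEquiv.left_inv ω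
    change _ = r ^ (trueSet ω).card * (1 - r) ^ (Fintype.card V - (trueSet ω).card) * g (indB (trueSet ω ∩ C))
    rw [← stepTest_indB_inter hg, hω]
  rw [step1]
  -- split `S = A ∪ B`, `A ⊆ C`, `B ⊆ Cᶜ`
  have step2 : ∑ S : Finset V, r ^ S.card * (1 - r) ^ (Fintype.card V - S.card) * g (indB (S ∩ C)) =
      ∑ A ∈ C.powerset, ∑ B ∈ Cᶜ.powerset,
        r ^ (A ∪ B).card * (1 - r) ^ (Fintype.card V - (A ∪ B).card) * g (indB A) := by
    rw [← Finset.sum_product' (f := fun A B => r ^ (A ∪ B).card * (1 - r) ^ (Fintype.card V - (A ∪ B).card) * g (indB A))]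
    refine Finset.sum_nbij' (fun S => (S ∩ C, S \ C)) (fun z => z.1 ∪ z.2) ?_ ?_ ?_ ?_ ?_
    · intro S _
      simp only [mem_product, mem_powerset]
      exact ⟨inter_subset_right, fun v hv => mem_compl.2 (mem_sdiff.1 hv).2⟩
    · intro z hz
      exact mem_univ _
    · intro S _
      simp only
      ext v; simp only [mem_union, mem_inter, mem_sdiff]; tauto
    · intro z hz
      obtain ⟨A, B⟩ := z
      simp only [mem_product, mem_powerset] at hz
      obtain ⟨hA, hB⟩ := hz
      simp only [Prod.mk.injEq]
      constructor
      · ext v; simp only [mem_inter, mem_union]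
        constructor
        · rintro ⟨h | h, hv⟩
          · exact h
          · exact absurd hv (mem_compl.1 (hB h))
        · intro h; exact ⟨Or.inl h, hA h⟩
      · ext v; simp only [mem_sdiff, mem_union]
        constructor
        · rintro ⟨h | h, hv⟩
          · exact absurd (hA h) hv
          · exact h
        · intro h; exact ⟨Or.inr h, mem_compl.1 (hB h)⟩
    · intro S _
      simp only
      have : S ∩ C ∪ S \ C = S := by ext v; simp only [mem_union, mem_inter, mem_sdiff]; tauto
      rw [this]
  rw [step2]
  refine Finset.sum_congr rfl fun A hA => ?_
  have hAC : A ⊆ C := mem_powerset.1 hA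
  -- inner sum over `B ⊆ Cᶜ`: the binomial identity
  have inner : ∀ B ∈ Cᶜ.powerset, r ^ (A ∪ B).card * (1 - r) ^ (Fintype.card V - (A ∪ B).card) * g (indB A) =
      (r ^ A.card * (1 - r) ^ (C.card - A.card) * g (indB A)) * (r ^ B.card * (1 - r) ^ (Cᶜ.card - B.card)) := by
    intro B hB
    have hBC : B ⊆ Cᶜ := mem_powerset.1 hB
    have hdisj : Disjoint A B := by
      rw [Finset.disjoint_left]; intro v hvA hvB
      exact (mem_compl.1 (hBC hvB)) (hAC hvA)
    rw [card_union_of_disjoint hdisj]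
    have hA' := card_le_card hAC
    have hB' := card_le_card hBC
    have hCc : Cᶜ.card = Fintype.card V - C.card := card_compl C
    have hCV : C.card ≤ Fintype.card V := card_le_univ C
    have : Fintype.card V - (A.card + B.card) = (C.card - A.card) + (Cᶜ.card - B.card) := by omega
    rw [this, pow_add, pow_add]; ring
  rw [Finset.sum_congr rfl inner, ← Finset.mul_sum, Finset.sum_pow_mul_eq_add_pow]
  ring

/-! ### Level sums and their monotonicity -/

/-- The sum of `g(𝟙_A)` over the subsets `A ⊆ C` with `#A = ℓ`. -/
def levelSum (C : Finset V) (g : (V → Bool) → ℝ) (ℓ : ℕ) : ℝ := ∑ A ∈ C.powersetCard ℓ, g (indB A)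

/-- The level decomposition grouped by cardinality: `E_{π_r}[g] = Σ_ℓ r^ℓ (1-r)^{k-ℓ} levelSum ℓ`. -/
theorem sum_wt_mul_eq_sum_levelSum {C : Finset V} {g : (V → Bool) → ℝ} (hg : StepTest C g) (r : ℝ) :
    ∑ ω : V → Bool, wt r ω * g ω =
      ∑ ℓ ∈ range (C.card + 1), r ^ ℓ * (1 - r) ^ (C.card - ℓ) * levelSum C g ℓ := by
  rw [sum_wt_mul_eq_sum_powerset hg, powerset_card_disjiUnion, sum_disjiUnion]
  refine Finset.sum_congr rfl fun ℓ _ => ?_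
  unfold levelSum
  rw [Finset.mul_sum]
  refine Finset.sum_congr rfl fun A hA => ?_
  rw [(mem_powersetCard.1 hA).2]

omit [Fintype V] in
/-- **Level sums of a monotone function increase on average**:
`(k - ℓ) · levelSum ℓ ≤ (ℓ + 1) · levelSum (ℓ + 1)` (double counting of the pairs `(A, v)`, `v ∈ C ∖ A`). -/
theorem levelSum_mono {C : Finset V} {g : (V → Bool) → ℝ} (hg : StepTest C g) (ℓ : ℕ) :
    ((C.card : ℝ) - ℓ) * levelSum C g ℓ ≤ (ℓ + 1) * levelSum C g (ℓ + 1) := by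
  classical
  by_cases hℓ : ℓ ≤ C.card
  swap
  · -- empty level
    have h0 : levelSum C g ℓ = 0 := by
      unfold levelSum; rw [powersetCard_eq_empty.2 (by omega)]; simp
    have h1 : levelSum C g (ℓ + 1) = 0 := by
      unfold levelSum; rw [powersetCard_eq_empty.2 (by omega)]; simp
    rw [h0, h1]; simp
  -- LHS = Σ_{A, #A = ℓ} Σ_{v ∈ C \ A} g(𝟙_A)
  have hL : ((C.card : ℝ) - ℓ) * levelSum C g ℓ = ∑ A ∈ C.powersetCard ℓ, ∑ v ∈ C \ A, g (indB A) := by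
    unfold levelSum
    rw [Finset.mul_sum]
    refine Finset.sum_congr rfl fun A hA => ?_
    obtain ⟨hAC, hcard⟩ := mem_powersetCard.1 hA
    rw [sum_const, card_sdiff_of_subset hAC, hcard, nsmul_eq_mul]
    push_cast [hℓ]
    ring
  -- RHS = Σ_{A', #A' = ℓ+1} Σ_{v ∈ A'} g(𝟙_{A'})
  have hR : ((ℓ : ℝ) + 1) * levelSum C g (ℓ + 1) = ∑ A ∈ C.powersetCard (ℓ + 1), ∑ v ∈ A, g (indB A) := by
    unfold levelSum
    rw [Finset.mul_sum]
    refine Finset.sum_congr rfl fun A hA => ?_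
    obtain ⟨-, hcard⟩ := mem_powersetCard.1 hA
    rw [sum_const, hcard, nsmul_eq_mul]
    push_cast; ring
  rw [hL, hR, Finset.sum_sigma', Finset.sum_sigma']
  -- compare termwise along the bijection `(A, v) ↦ (insert v A, v)`
  calc ∑ x ∈ (C.powersetCard ℓ).sigma fun A => C \ A, g (indB x.1)
      ≤ ∑ x ∈ (C.powersetCard ℓ).sigma fun A => C \ A, g (indB (insert x.2 x.1)) := by
        refine Finset.sum_le_sum fun x hx => hg.1 _ _ fun v _ => ?_
        change decide (v ∈ x.1) ≤ decide (v ∈ insert x.2 x.1)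
        rw [Bool.le_iff_imp]
        simp only [decide_eq_true_eq]
        exact fun h => mem_insert_of_mem h
    _ = ∑ x ∈ (C.powersetCard (ℓ + 1)).sigma fun A => A, g (indB x.1) := by
        refine Finset.sum_nbij' (fun x => ⟨insert x.2 x.1, x.2⟩) (fun x => ⟨x.1.erase x.2, x.2⟩) ?_ ?_ ?_ ?_ ?_
        · rintro ⟨A, v⟩ hx
          rw [mem_sigma] at hx ⊢
          obtain ⟨hA, hv⟩ := hx
          obtain ⟨hAC, hcard⟩ := mem_powersetCard.1 hA
          obtain ⟨hvC, hvA⟩ := mem_sdiff.1 hv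
          exact ⟨mem_powersetCard.2 ⟨insert_subset hvC hAC, by rw [card_insert_of_notMem hvA, hcard]⟩,
            mem_insert_self _ _⟩
        · rintro ⟨A, v⟩ hx
          rw [mem_sigma] at hx ⊢
          obtain ⟨hA, hv⟩ := hx
          obtain ⟨hAC, hcard⟩ := mem_powersetCard.1 hA
          refine ⟨mem_powersetCard.2 ⟨(erase_subset _ _).trans hAC, ?_⟩, mem_sdiff.2 ⟨hAC hv, notMem_erase _ _⟩⟩
          rw [card_erase_of_mem hv, hcard]; rfl
        · rintro ⟨A, v⟩ hx
          rw [mem_sigma] at hx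
          obtain ⟨-, hv⟩ := hx
          have hvA : v ∉ A := (mem_sdiff.1 hv).2
          simp [erase_insert hvA]
        · rintro ⟨A, v⟩ hx
          rw [mem_sigma] at hx
          obtain ⟨-, hv⟩ := hx
          simp [insert_erase hv]
        · rintro ⟨A, v⟩ _
          rfl

/-! ### Binomial tails and Abel summation -/

/-- The binomial tail `T_j(r) = P(Bin(k, r) ≥ j) = Σ_{j ≤ ℓ ≤ k} (k choose ℓ) r^ℓ (1-r)^{k-ℓ}`. -/
def binTail (k : ℕ) (r : ℝ) (j : ℕ) : ℝ :=
  ∑ ℓ ∈ range (k + 1), if j ≤ ℓ then (k.choose ℓ : ℝ) * r ^ ℓ * (1 - r) ^ (k - ℓ) else 0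

/-- The level average `ḡ(ℓ) = levelSum ℓ / (k choose ℓ)`. -/
noncomputable def levelAvg (C : Finset V) (g : (V → Bool) → ℝ) (ℓ : ℕ) : ℝ := levelSum C g ℓ / (C.card.choose ℓ : ℝ)

omit [Fintype V] in
/-- `levelSum ℓ = (k choose ℓ) · ḡ(ℓ)`. -/
theorem levelSum_eq_choose_mul_levelAvg (C : Finset V) (g : (V → Bool) → ℝ) {ℓ : ℕ} (hℓ : ℓ ≤ C.card) :
    levelSum C g ℓ = (C.card.choose ℓ : ℝ) * levelAvg C g ℓ := by
  unfold levelAvg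
  have : (C.card.choose ℓ : ℝ) ≠ 0 := by exact_mod_cast (Nat.choose_pos hℓ).ne'
  field_simp

omit [Fintype V] in
/-- **Level averages of a monotone function are nondecreasing**: `ḡ(ℓ) ≤ ḡ(ℓ+1)` for `ℓ + 1 ≤ k`. -/
theorem levelAvg_mono {C : Finset V} {g : (V → Bool) → ℝ} (hg : StepTest C g) {ℓ : ℕ} (hℓ : ℓ + 1 ≤ C.card) :
    levelAvg C g ℓ ≤ levelAvg C g (ℓ + 1) := by
  have h := levelSum_mono hg ℓ
  rw [levelSum_eq_choose_mul_levelAvg C g (by omega), levelSum_eq_choose_mul_levelAvg C g hℓ] at h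
  -- `(k-ℓ) C(k,ℓ) = (ℓ+1) C(k,ℓ+1)`
  have hid : ((C.card : ℝ) - ℓ) * (C.card.choose ℓ : ℝ) = (ℓ + 1) * (C.card.choose (ℓ + 1) : ℝ) := by
    have := Nat.choose_succ_right_eq C.card ℓ
    have hle : ℓ ≤ C.card := by omega
    have e : ((C.card.choose (ℓ + 1) * (ℓ + 1) : ℕ) : ℝ) = ((C.card.choose ℓ * (C.card - ℓ) : ℕ) : ℝ) := by
      exact_mod_cast this
    push_cast [hle] at e
    linarith
  have hpos : 0 < ((ℓ : ℝ) + 1) * (C.card.choose (ℓ + 1) : ℝ) := by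
    have : 0 < C.card.choose (ℓ + 1) := Nat.choose_pos hℓ
    positivity
  have h' : ((ℓ : ℝ) + 1) * (C.card.choose (ℓ + 1) : ℝ) * levelAvg C g ℓ ≤
      ((ℓ : ℝ) + 1) * (C.card.choose (ℓ + 1) : ℝ) * levelAvg C g (ℓ + 1) := by
    calc ((ℓ : ℝ) + 1) * (C.card.choose (ℓ + 1) : ℝ) * levelAvg C g ℓ
        = ((C.card : ℝ) - ℓ) * (C.card.choose ℓ : ℝ) * levelAvg C g ℓ := by rw [hid]
      _ = ((C.card : ℝ) - ℓ) * ((C.card.choose ℓ : ℝ) * levelAvg C g ℓ) := by ring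
      _ ≤ (ℓ + 1) * ((C.card.choose (ℓ + 1) : ℝ) * levelAvg C g (ℓ + 1)) := h
      _ = _ := by ring
  exact le_of_mul_le_mul_left h' hpos

/-- **Abel summation**: `E_{π_r}[g] = ḡ(0) + Σ_{j=1}^{k} (ḡ(j) - ḡ(j-1)) T_j(r)` for a step test function `g` of
`C`, `k = #C`. -/
theorem sum_wt_mul_eq_tails {C : Finset V} {g : (V → Bool) → ℝ} (hg : StepTest C g) (r : ℝ) :
    ∑ ω : V → Bool, wt r ω * g ω = levelAvg C g 0 +
      ∑ j ∈ range (C.card + 1), (if 1 ≤ j then (levelAvg C g j - levelAvg C g (j - 1)) * binTail C.card r j else 0) := by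
  set k := C.card with hk
  rw [sum_wt_mul_eq_sum_levelSum hg r, ← hk]
  -- write level sums through averages
  have e1 : ∑ ℓ ∈ range (k + 1), r ^ ℓ * (1 - r) ^ (k - ℓ) * levelSum C g ℓ =
      ∑ ℓ ∈ range (k + 1), ((k.choose ℓ : ℝ) * r ^ ℓ * (1 - r) ^ (k - ℓ)) * levelAvg C g ℓ := by
    refine Finset.sum_congr rfl fun ℓ hℓ => ?_
    rw [levelSum_eq_choose_mul_levelAvg C g (by rw [← hk]; exact Nat.lt_succ_iff.1 (mem_range.1 hℓ))]; ring
  rw [e1]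
  set P : ℕ → ℝ := fun ℓ => (k.choose ℓ : ℝ) * r ^ ℓ * (1 - r) ^ (k - ℓ) with hP
  set a : ℕ → ℝ := levelAvg C g with ha
  have hT : ∀ j, binTail k r j = ∑ ℓ ∈ range (k + 1), if j ≤ ℓ then P ℓ else 0 := fun j => rfl
  -- total mass `Σ P = 1`
  have hP1 : ∑ ℓ ∈ range (k + 1), P ℓ = 1 := by
    have := (add_pow r (1 - r) k).symm
    rw [show r + (1 - r) = 1 by ring, one_pow] at this
    rw [← this]
    refine Finset.sum_congr rfl fun ℓ _ => ?_
    simp only [hP]; ring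
  -- telescoping: Σ_{1 ≤ j ≤ ℓ} (a j - a (j-1)) = a ℓ - a 0
  have tele : ∀ ℓ, ℓ ≤ k → ∑ j ∈ range (k + 1), (if 1 ≤ j ∧ j ≤ ℓ then a j - a (j - 1) else 0) = a ℓ - a 0 := by
    intro ℓ hℓ
    induction ℓ with
    | zero =>
      rw [sub_self]
      exact Finset.sum_eq_zero fun j _ => by rw [if_neg]; omega
    | succ ℓ ih =>
      have ih' := ih (by omega)
      have hsplit : ∀ j ∈ range (k + 1), (if 1 ≤ j ∧ j ≤ ℓ + 1 then a j - a (j - 1) else 0) =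
          (if 1 ≤ j ∧ j ≤ ℓ then a j - a (j - 1) else 0) + (if j = ℓ + 1 then a j - a (j - 1) else 0) := by
        intro j _
        by_cases h1 : 1 ≤ j ∧ j ≤ ℓ
        · rw [if_pos h1, if_pos ⟨h1.1, by omega⟩, if_neg (by omega), add_zero]
        · by_cases h2 : j = ℓ + 1
          · rw [if_pos ⟨by omega, by omega⟩, if_neg h1, if_pos h2, zero_add]
          · rw [if_neg (by omega), if_neg h1, if_neg h2, add_zero]
      rw [Finset.sum_congr rfl hsplit, Finset.sum_add_distrib, ih', Finset.sum_ite_eq' (range (k + 1)) (ℓ + 1),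
        if_pos (mem_range.2 (by omega))]
      simp only [Nat.add_sub_cancel]; ring
  -- swap the sums in the Abel term
  have swap : ∑ j ∈ range (k + 1), (if 1 ≤ j then (a j - a (j - 1)) * ∑ ℓ ∈ range (k + 1), (if j ≤ ℓ then P ℓ else 0) else 0)
      = ∑ ℓ ∈ range (k + 1), P ℓ * (a ℓ - a 0) := by
    have e2 : ∀ j ∈ range (k + 1), (if 1 ≤ j then (a j - a (j - 1)) * ∑ ℓ ∈ range (k + 1), (if j ≤ ℓ then P ℓ else 0) else 0)
        = ∑ ℓ ∈ range (k + 1), P ℓ * (if 1 ≤ j ∧ j ≤ ℓ then a j - a (j - 1) else 0) := by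
      intro j _
      by_cases h1 : 1 ≤ j
      · rw [if_pos h1, Finset.mul_sum]
        refine Finset.sum_congr rfl fun ℓ _ => ?_
        by_cases h2 : j ≤ ℓ
        · rw [if_pos h2, if_pos ⟨h1, h2⟩]; ring
        · rw [if_neg h2, if_neg (fun h => h2 h.2)]; ring
      · rw [if_neg h1]
        refine (Finset.sum_eq_zero fun ℓ _ => ?_).symm
        rw [if_neg (fun h => h1 h.1), mul_zero]
    rw [Finset.sum_congr rfl e2, Finset.sum_comm]
    refine Finset.sum_congr rfl fun ℓ hℓ => ?_
    rw [← Finset.mul_sum, tele ℓ (Nat.lt_succ_iff.1 (mem_range.1 hℓ))]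
  have swap' : ∑ j ∈ range (k + 1), (if 1 ≤ j then (a j - a (j - 1)) * binTail k r j else 0)
      = ∑ ℓ ∈ range (k + 1), P ℓ * (a ℓ - a 0) := by
    rw [← swap]
    exact Finset.sum_congr rfl fun j _ => by rw [hT j]
  rw [swap']
  -- Σ P ℓ a ℓ = a 0 · Σ P + Σ P ℓ (a ℓ - a 0)
  have : ∑ ℓ ∈ range (k + 1), P ℓ * a ℓ = a 0 * ∑ ℓ ∈ range (k + 1), P ℓ + ∑ ℓ ∈ range (k + 1), P ℓ * (a ℓ - a 0) := by
    rw [Finset.mul_sum, ← Finset.sum_add_distrib]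
    exact Finset.sum_congr rfl fun ℓ _ => by ring
  rw [this, hP1, mul_one]

/-- **Mixtures of i.i.d. laws dominate `π_s` on monotone tests when their binomial tails do.**  For weights `a x`
(any signs are allowed in the identity, the hypothesis is used with the nonnegative gaps of the level averages),
rates `r x` and `s`: if `(Σ_x a x) · T_j(s) ≤ Σ_x a x · T_j(r x)` for `j = 1, …, #C`, then for every step test
function `g` of `C`, `(Σ_x a x) · E_{π_s}[g] ≤ Σ_x a x · E_{π_{r x}}[g]`. -/
theorem mixture_dominates_of_tails {X : Type*} [Fintype X] (C : Finset V) (a : X → ℝ) (r : X → ℝ) (s : ℝ)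
    (htail : ∀ j, 1 ≤ j → j ≤ C.card → (∑ x, a x) * binTail C.card s j ≤ ∑ x, a x * binTail C.card (r x) j)
    {g : (V → Bool) → ℝ} (hg : StepTest C g) :
    (∑ x, a x) * (∑ ω : V → Bool, wt s ω * g ω) ≤ ∑ x, a x * ∑ ω : V → Bool, wt (r x) ω * g ω := by
  simp_rw [sum_wt_mul_eq_tails hg]
  have eR : ∑ x, a x * (levelAvg C g 0 + ∑ j ∈ range (C.card + 1),
      (if 1 ≤ j then (levelAvg C g j - levelAvg C g (j - 1)) * binTail C.card (r x) j else 0)) =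
      (∑ x, a x) * levelAvg C g 0 + ∑ j ∈ range (C.card + 1),
        (if 1 ≤ j then (levelAvg C g j - levelAvg C g (j - 1)) * ∑ x, a x * binTail C.card (r x) j else 0) := by
    simp_rw [mul_add]
    rw [Finset.sum_add_distrib, ← Finset.sum_mul]
    congr 1
    simp_rw [Finset.mul_sum]
    rw [Finset.sum_comm]
    refine Finset.sum_congr rfl fun j _ => ?_
    by_cases h1 : 1 ≤ j
    · simp_rw [if_pos h1]
      exact Finset.sum_congr rfl fun x _ => by ring
    · simp_rw [if_neg h1]; simp
  have eL : (∑ x, a x) * (levelAvg C g 0 + ∑ j ∈ range (C.card + 1),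
      (if 1 ≤ j then (levelAvg C g j - levelAvg C g (j - 1)) * binTail C.card s j else 0)) =
      (∑ x, a x) * levelAvg C g 0 + ∑ j ∈ range (C.card + 1),
        (if 1 ≤ j then (levelAvg C g j - levelAvg C g (j - 1)) * ((∑ x, a x) * binTail C.card s j) else 0) := by
    rw [mul_add, Finset.mul_sum]
    congr 1
    refine Finset.sum_congr rfl fun j _ => ?_
    by_cases h1 : 1 ≤ j
    · rw [if_pos h1, if_pos h1]; ring
    · rw [if_neg h1, if_neg h1, mul_zero]
  rw [eR, eL]
  refine add_le_add le_rfl (Finset.sum_le_sum fun j hj => ?_)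
  by_cases h1 : 1 ≤ j
  · rw [if_pos h1, if_pos h1]
    have hjk : j ≤ C.card := Nat.lt_succ_iff.1 (mem_range.1 hj)
    have hgap : 0 ≤ levelAvg C g j - levelAvg C g (j - 1) := by
      have := levelAvg_mono hg (ℓ := j - 1) (by omega)
      rw [show j - 1 + 1 = j by omega] at this
      linarith
    exact mul_le_mul_of_nonneg_left (htail j h1 hjk) hgap
  · rw [if_neg h1, if_neg h1]

end AdaptDom

end Summit.CriticalPhenomena.PercolationContinuityZ3.Theorems.Pcint
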